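import Summits.QuantumFields.YangMills.Theorems.SwapVirialDeficitSharpSwapVolumeLawOfPrincipalClass
import Summits.QuantumFields.YangMills.Theorems.SwapVirialDeficitOddSectorExplicitGap
import HarnessLib

/-!
# Route `SwapVirialDeficit` (YangMills): `SwapGluedStiffness` from the PRINCIPAL sharp law and ONE minus class
# (crux ⟨stmt-QuantumFields-24197⟩; the odd classes are discharged UNIFORMLY in `L` by ✓`OddSectorGap.swap_oddSector_void_uniform`)

Of the three non-principal classes `010, 001, 011` in hypothesis (S) of ✓`SharpSigma.swapGluedStiffness_of_principalClassSharpLaw`, the two ODD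
ones (`010`, `011`: `z 0 ≠ z 1`) are VOID below `u < (1248L³)⁻²` by the explicit defect bound ✓`oddDefect_ge_eighth` — uniformly in `L`, with a
polynomial threshold.  Hence ⟨24197⟩ follows from TWO analytic statements only (both stated INLINE as the hypothesis `hPM`):
* (P)  the SHARP small-ball law of the principal class `z = 000`: `μ_L{F^S_000 ≤ t} = v(L)t^{9L⁴−1}(1 ± K₁L^{q₁}t^θ)`, `|log v(L)| ≤ K₁L^{q₁}`;
* (M)  the uniform RELATIVE SMALLNESS of the minus class `z = 001`: `μ_L{F^S_001 ≤ t} ≤ K₁L^{q₁}t^θ·v(L)t^{9L⁴−1}`,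
on `(0, (K₁L^{q₁})⁻¹]`.  ★★★ `swapGluedStiffness_of_principal_and_minusClass : (P ∧ M) → Theses.SwapVirialDeficit.SwapGluedStiffness`
(window constants enlarged to `K₁ + 1248²`, `q₁ + 6` so that the range lies inside the odd void).
HONEST FRAMING: conditional bookkeeping; (P), (M), ⟨24197⟩, ⟨24194⟩ and every rung / summit statement stay OPEN; the Yang–Mills mass gap is NOT
proved; no summit is proved by a line.  THEOREMS ONLY (0 `def`, 0 `sorry`), standard axioms.  Seat ym-line-fcl-p3 g43 (cell ym-idea-1, free
hands), `--supports stmt-QuantumFields-24197`.  References: [cite: tHooft1979]; [cite: Griffiths1964]; [cite: Luscher1983, §2].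
-/

set_option autoImplicit false

noncomputable section

namespace Summit.QuantumFields.YangMills.Theorems.SwapVirialDeficit.SharpSigma

open MeasureTheory Set
open scoped BigOperators
open Summit.QuantumFields.YangMills.Theorems.FemtoTransferGap
open Summit.QuantumFields.YangMills.Theorems.VirialFluxGap.RingDeficit
open Summit.QuantumFields.YangMills.Theorems.SwapVirialDeficit.SwapRing
open Summit.QuantumFields.YangMills.Theorems.SwapVirialDeficit.OddSectorGap (swap_oddSector_void_uniform)

/-- The non-principal labels of the class `z 0 = 0`: either odd (`z 0 ≠ z 1`) or the minus label `001`. [folklore] -/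
theorem odd_or_eq_minus (z : Fin 3 → Bool) (h0 : z 0 = false) (hz : z ≠ fun _ => false) :
    z 0 ≠ z 1 ∨ z = fun k => decide (k = 2) := by
  by_cases h1 : z 1 = true
  · left; rw [h0, h1]; decide
  · right
    have h1' : z 1 = false := by cases h : z 1 <;> simp_all
    have h2 : z 2 = true := by
      by_contra h2
      have h2' : z 2 = false := by cases h : z 2 <;> simp_all
      apply hz
      funext k
      fin_cases k <;> assumption
    funext k
    fin_cases k
    · simpa using h0
    · simpa using h1'
    · simpa using h2

/-- ★★★ **`(P) + (M) ⟹ SwapGluedStiffness` BY NAME**: the sharp small-ball law of the principal σ-class and the uniform relative smallness of the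
single minus class `001` imply the route crux ⟨stmt-QuantumFields-24197⟩; the odd classes are void uniformly in `L`
(✓`swap_oddSector_void_uniform`). [cite: tHooft1979] [cite: Griffiths1964] -/
theorem swapGluedStiffness_of_principal_and_minusClass
    (hPM : ∃ K₁ : ℝ, 0 < K₁ ∧ ∃ q₁ : ℝ, 0 ≤ q₁ ∧ ∃ θ : ℝ, 0 < θ ∧ θ ≤ 1 ∧ ∃ v : ℕ → ℝ, ∃ L₀ : ℕ,
      ∀ (L : ℕ) [NeZero L], L₀ ≤ L → 0 < v L ∧ |Real.log (v L)| ≤ K₁ * (L : ℝ) ^ q₁ ∧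
        ∀ t : ℝ, 0 < t → t ≤ (K₁ * (L : ℝ) ^ q₁)⁻¹ →
          |(ringMeasure L).real {P | swapRingDeficit L (fun _ => false) P ≤ t} / (v L * t ^ (9 * L ^ 4 - 1)) - 1| ≤
              K₁ * (L : ℝ) ^ q₁ * t ^ θ ∧
            (ringMeasure L).real {P | swapRingDeficit L (fun k => decide (k = 2)) P ≤ t} ≤
              K₁ * (L : ℝ) ^ q₁ * t ^ θ * (v L * t ^ (9 * L ^ 4 - 1))) :
    Summit.QuantumFields.YangMills.Theses.SwapVirialDeficit.SwapGluedStiffness := by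
  obtain ⟨K₁, hK₁, q₁, hq₁, θ, hθ, hθ1, v, L₀, hV⟩ := hPM
  refine swapGluedStiffness_of_principalClassSharpLaw
    ⟨K₁ + 1248 ^ 2, by positivity, q₁ + 6, by linarith, θ, hθ, hθ1, v, max L₀ 1, ?_⟩
  intro L _ hL
  have hL₀ : L₀ ≤ L := le_trans (le_max_left _ _) hL
  have hL1 : (1 : ℝ) ≤ (L : ℝ) := by exact_mod_cast le_trans (le_max_right _ _) hL
  have hL0 : (0 : ℝ) < (L : ℝ) := by linarith
  obtain ⟨hv, hlogv, hvol⟩ := hV L hL₀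
  -- the enlarged window constant dominates the old one and the odd-void threshold
  have hLq : (L : ℝ) ^ q₁ ≤ (L : ℝ) ^ (q₁ + 6) := Real.rpow_le_rpow_of_exponent_le hL1 (by linarith)
  have hLq0 : 0 < (L : ℝ) ^ q₁ := Real.rpow_pos_of_pos hL0 _
  have hκ : K₁ * (L : ℝ) ^ q₁ ≤ (K₁ + 1248 ^ 2) * (L : ℝ) ^ (q₁ + 6) :=
    mul_le_mul (by nlinarith) hLq hLq0.le (by positivity)
  have hκ0 : 0 < K₁ * (L : ℝ) ^ q₁ := by positivity
  have hL6 : (1248 * (L : ℝ) ^ 3) ^ 2 ≤ 1248 ^ 2 * (L : ℝ) ^ (q₁ + 6) := by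
    have h6 : (L : ℝ) ^ (6 : ℕ) ≤ (L : ℝ) ^ (q₁ + 6) := by
      rw [← Real.rpow_natCast]
      exact Real.rpow_le_rpow_of_exponent_le hL1 (by push_cast; linarith)
    nlinarith [h6]
  have hodd : ((K₁ + 1248 ^ 2) * (L : ℝ) ^ (q₁ + 6))⁻¹ < ((1248 * (L : ℝ) ^ 3) ^ 2)⁻¹ := by
    apply inv_strictAnti₀ (by positivity)
    have : 0 < K₁ * (L : ℝ) ^ (q₁ + 6) := by positivity
    nlinarith [hL6, this]
  refine ⟨hv, hlogv.trans hκ, fun t ht htle => ?_⟩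
  have htle' : t ≤ (K₁ * (L : ℝ) ^ q₁)⁻¹ := htle.trans (inv_anti₀ hκ0 hκ)
  obtain ⟨hP, hM⟩ := hvol t ht htle'
  have htθ : 0 ≤ t ^ θ := Real.rpow_nonneg ht.le _
  have hvt : 0 ≤ v L * t ^ (9 * L ^ 4 - 1) := by positivity
  have herr : K₁ * (L : ℝ) ^ q₁ * t ^ θ ≤ (K₁ + 1248 ^ 2) * (L : ℝ) ^ (q₁ + 6) * t ^ θ := mul_le_mul_of_nonneg_right hκ htθ
  refine ⟨hP.trans herr, fun z h0 hz => ?_⟩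
  rcases odd_or_eq_minus z h0 hz with hodd' | hmin
  · -- odd class: void
    rw [swap_oddSector_void_uniform (L := L) z hodd' (lt_of_le_of_lt htle hodd)]
    positivity
  · -- the minus class `001`
    rw [hmin]
    exact hM.trans (mul_le_mul_of_nonneg_right herr hvt)

end Summit.QuantumFields.YangMills.Theorems.SwapVirialDeficit.SharpSigma

end
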